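import Mathlib
import Summits.Ventures.PercRepro2.LocRows
import Summits.Ventures.PercRepro2.SwRow
import Summits.Ventures.PercRepro2.SwOut
import Summits.Ventures.PercRepro2.SwAllRow
import Summits.Ventures.PercRepro2.SwOutAll
import Summits.Ventures.PercRepro2.SwOutArmFlip
import Summits.Ventures.PercRepro2.SwOutArmThm
import Summits.Ventures.PercRepro2.SwOutCoreDefs
import Summits.Ventures.PercRepro2.SwOutCoreHull

/-!
# The e-core cube: vocabulary (blind cell PercRepro2, night-4 g16, 2026-08-26;
proofs/NIGHT4-G15.md §4 (Theorem A⁺), proofs/NIGHT4-G16.md §1)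

Theorem A⁺ lets the junction `u` be ADJACENT to `h`.  The class of h–u edges (`huEdges`) is then
ONE MORE CUBE COORDINATE: a cube point is `ω : Config (Option ι)`, `ω (some i)` the colour of the
arm `A i` and `ω none` the colour of the h–u edges.  `CoreBaseE` is the core base of
`SwOutCoreDefs` with the h–u edges allowed (every edge at `h` goes to `u` or into an arm, every
edge at `u` to `h` or into an arm; all of them red at the base); `coreRealE ζ ω` flips the arms
assigned `false` and, when `ω none = false`, the h–u edges.  The red cluster of `h` of a cube point
is `redSetE ω` — `h`, the red h-arms, and, when the h–u edges are red OR some red h-arm is adjacent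
to `u` (`uRedE ω`), `u` with the red pure arms (proved in `SwOutEdgeHull`).  This file: the
definitions and the bookkeeping of which edges a cube point recolours.
-/

namespace Summit.Ventures.PercRepro2

namespace LocRows

open Hull

variable {V : Type*} {E : Type*}

open scoped Classical

variable (ends : E → Sym2 V)

/-- The edges joining `h` and `u`. -/
def huEdges (h u : V) : Set E := {e | ends e = s(h, u)}

variable {ends}

/-- Membership in `huEdges`. -/
lemma mem_huEdges_iff {h u : V} {e : E} : e ∈ huEdges ends h u ↔ ends e = s(h, u) := Iff.rfl

/-- **The data of an e-core cube**: a base configuration `ζ` (every arm red, the h–u edges red),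
the junction `u` adjacent to `h`, the hull `H` of the base, and a family of arms `A i` (pairwise
disjoint, covering `H ∖ {h, u}`, no edge between two arms, no edge from `H` to the outside that is
red); `h` and `u` see only each other and arms, by red edges; each h-arm is red-connected to `h`
inside itself, each pure arm red-connected to `u` inside itself, and pure arms have no edge to
`h`. -/
structure CoreBaseE (ends : E → Sym2 V) (ζ : Config E) (h u : V) (H : Set V) {ι : Type*}
    (A : ι → Set V) (pure : ι → Prop) : Prop where
  hne : h ≠ u
  h_mem : h ∈ H
  u_mem : u ∈ H
  hu_exists : ∃ e, ends e = s(h, u)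
  bdry_blue : ∀ e x y, ends e = s(x, y) → x ∈ H → y ∉ H → ζ e = false
  arm_sub : ∀ i, ∀ x ∈ A i, x ∈ H ∧ x ≠ h ∧ x ≠ u
  arm_nonempty : ∀ i, (A i).Nonempty
  arm_disj : ∀ i j, i ≠ j → ∀ x, x ∈ A i → x ∉ A j
  arm_cover : ∀ x ∈ H, x ≠ h → x ≠ u → ∃ i, x ∈ A i
  no_cross : ∀ i j, i ≠ j → ∀ e x y, ends e = s(x, y) → x ∈ A i → y ∈ A j → False
  h_edges : ∀ e x, ends e = s(h, x) → x = u ∨ ∃ i, x ∈ A i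
  h_red : ∀ e x, ends e = s(h, x) → ζ e = true
  u_edges : ∀ e x, ends e = s(u, x) → x = h ∨ ∃ i, x ∈ A i
  u_red : ∀ e x, ends e = s(u, x) → ζ e = true
  harm_conn : ∀ i, ¬ pure i → ∀ x ∈ A i, x ∈ cluster ends (insideConfig ends (A i ∪ {h}) ζ) h
  pure_conn : ∀ i, pure i → ∀ x ∈ A i, x ∈ cluster ends (insideConfig ends (A i ∪ {u}) ζ) u
  pure_no_h : ∀ i, pure i → ∀ e x, ends e = s(h, x) → x ∉ A i

section Defs

variable {ι : Type*} (A : ι → Set V)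

variable (ends) in
/-- The realisation of a cube point: the arms assigned `false` are flipped in the base, and the
h–u edges are flipped when `ω none = false`. -/
noncomputable def coreRealE (h u : V) (ζ : Config E) (ω : Config (Option ι)) : Config E :=
  fun e => if ends e = s(h, u) then (if ω none = true then ζ e else !ζ e)
    else coreReal ends A ζ (ω ∘ some) e

variable (ends) in
/-- `u` is red iff the h–u edges are red or some red h-arm is adjacent to `u`. -/
def uRedE (u : V) (pure : ι → Prop) (ω : Config (Option ι)) : Prop :=
  ω none = true ∨ uRed ends A u pure (ω ∘ some)

variable (ends) in
/-- The red cluster of `h` of a cube point: `h`, the red h-arms, and — when the h–u edges are red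
or some red h-arm is adjacent to `u` — `u` with the red pure arms. -/
def redSetE (h u : V) (pure : ι → Prop) (ω : Config (Option ι)) : Set V :=
  {h} ∪ {x | ∃ i, ω (some i) = true ∧ ¬ pure i ∧ x ∈ A i} ∪
    {x | uRedE ends A u pure ω ∧ (x = u ∨ ∃ i, ω (some i) = true ∧ pure i ∧ x ∈ A i)}

variable {A}

/-- Membership in `redSetE`. -/
lemma mem_redSetE_iff {h u : V} {pure : ι → Prop} {ω : Config (Option ι)} {x : V} :
    x ∈ redSetE ends A h u pure ω ↔
      x = h ∨ (∃ i, ω (some i) = true ∧ ¬ pure i ∧ x ∈ A i) ∨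
        (uRedE ends A u pure ω ∧ (x = u ∨ ∃ i, ω (some i) = true ∧ pure i ∧ x ∈ A i)) := by
  simp only [redSetE, Set.mem_union, Set.mem_singleton_iff, Set.mem_setOf_eq, or_assoc]

/-- `redSetE ω ⊆ redAll (ω ∘ some)`. -/
lemma redSetE_subset_redAll {h u : V} {pure : ι → Prop} (ω : Config (Option ι)) :
    redSetE ends A h u pure ω ⊆ redAll A h u (ω ∘ some) := by
  intro x hx
  rw [mem_redSetE_iff] at hx
  rw [mem_redAll_iff]
  rcases hx with rfl | ⟨i, hi, _, hx⟩ | ⟨_, rfl | ⟨i, hi, _, hx⟩⟩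
  · exact Or.inl rfl
  · exact Or.inr (Or.inr ⟨i, hi, hx⟩)
  · exact Or.inr (Or.inl rfl)
  · exact Or.inr (Or.inr ⟨i, hi, hx⟩)

/-- `uRedE` is monotone in the cube point. -/
lemma uRedE_mono {u : V} {pure : ι → Prop} {ω ω' : Config (Option ι)} (hω : ω ≤ ω')
    (hu : uRedE ends A u pure ω) : uRedE ends A u pure ω' := by
  have hle : ∀ j, ω j = true → ω' j = true := by
    intro j hj
    have := hω j
    rw [hj] at this
    cases h' : ω' j
    · rw [h'] at this; exact absurd this (by simp)
    · rfl
  rcases hu with hu | ⟨i, hi, hpi, e, x, hux, hx⟩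
  · exact Or.inl (hle none hu)
  · exact Or.inr ⟨i, hle (some i) hi, hpi, e, x, hux, hx⟩

/-- `redSetE` grows with the cube point. -/
lemma redSetE_mono {h u : V} {pure : ι → Prop} {ω ω' : Config (Option ι)} (hω : ω ≤ ω') :
    redSetE ends A h u pure ω ⊆ redSetE ends A h u pure ω' := by
  have hle : ∀ j, ω j = true → ω' j = true := by
    intro j hj
    have := hω j
    rw [hj] at this
    cases h' : ω' j
    · rw [h'] at this; exact absurd this (by simp)
    · rfl
  intro x hx
  rw [mem_redSetE_iff] at hx ⊢
  rcases hx with rfl | ⟨i, hi, hpi, hx⟩ | ⟨hu, rfl | ⟨i, hi, hpi, hx⟩⟩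
  · exact Or.inl rfl
  · exact Or.inr (Or.inl ⟨i, hle _ hi, hpi, hx⟩)
  · exact Or.inr (Or.inr ⟨uRedE_mono hω hu, Or.inl rfl⟩)
  · exact Or.inr (Or.inr ⟨uRedE_mono hω hu, Or.inr ⟨i, hle _ hi, hpi, hx⟩⟩)

/-- The arm coordinates of `flipAll ω` are `flipAll` of the arm coordinates. -/
lemma flipAll_comp_some (ω : Config (Option ι)) : flipAll ω ∘ some = flipAll (ω ∘ some) := by
  funext i; rfl

/-- The arm coordinates are monotone. -/
lemma comp_some_le_comp_some {ω ω' : Config (Option ι)} (hω : ω ≤ ω') : ω ∘ some ≤ ω' ∘ some :=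
  fun i => hω (some i)

end Defs

section Base

variable {ι : Type*} {A : ι → Set V} {pure : ι → Prop} {ζ : Config E} {h u : V} {H : Set V}
  (hb : CoreBaseE ends ζ h u H A pure)
include hb

/-- No loop at `h`. -/
lemma CoreBaseE.loop_h (e : E) : ends e ≠ s(h, h) := by
  intro he
  rcases hb.h_edges e h he with hhu | ⟨i, hi⟩
  · exact hb.hne hhu
  · exact (hb.arm_sub i h hi).2.1 rfl

/-- No loop at `u`. -/
lemma CoreBaseE.loop_u (e : E) : ends e ≠ s(u, u) := by
  intro he
  rcases hb.u_edges e u he with huh | ⟨i, hi⟩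
  · exact hb.hne huh.symm
  · exact (hb.arm_sub i u hi).2.2 rfl

/-- `h` lies in no arm. -/
lemma CoreBaseE.h_notMem_arm (i : ι) : h ∉ A i := fun hh => (hb.arm_sub i h hh).2.1 rfl

/-- `u` lies in no arm. -/
lemma CoreBaseE.u_notMem_arm (i : ι) : u ∉ A i := fun hu => (hb.arm_sub i u hu).2.2 rfl

/-- The two ends of an edge in arms lie in the same arm. -/
lemma CoreBaseE.arm_eq_of_edge {i j : ι} {e : E} {x y : V} (hxy : ends e = s(x, y)) (hx : x ∈ A i)
    (hy : y ∈ A j) : i = j := by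
  by_contra hij
  exact hb.no_cross i j hij e x y hxy hx hy

/-- The h–u edges are red at the base. -/
lemma CoreBaseE.hu_red {e : E} (he : ends e = s(h, u)) : ζ e = true := hb.h_red e u he

/-- An h–u edge touches no arm. -/
lemma CoreBaseE.hu_not_touches {e : E} (he : ends e = s(h, u)) :
    e ∉ touches ends (allArms A) := by
  rintro ⟨x, ⟨i, hx⟩, y, hxy⟩
  rw [he, Sym2.eq_iff] at hxy
  rcases hxy with ⟨rfl, _⟩ | ⟨_, rfl⟩
  · exact hb.h_notMem_arm i hx
  · exact hb.u_notMem_arm i hx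

/-- An edge with an end in an arm is not an h–u edge. -/
lemma CoreBaseE.not_hu_of_mem {i : ι} {e : E} {x y : V} (hxy : ends e = s(x, y)) (hx : x ∈ A i) :
    ends e ≠ s(h, u) := fun he =>
  hb.hu_not_touches he ⟨x, ⟨i, hx⟩, y, hxy⟩

/-- An edge with an end in `A i` touches the arms assigned `false` iff `ω i = false`. -/
lemma CoreBaseE.touches_armsFalseC_iff {ω : Config ι} {i : ι} {e : E} {x y : V}
    (hxy : ends e = s(x, y)) (hx : x ∈ A i) :
    e ∈ touches ends (armsFalseC A ω) ↔ ω i = false := by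
  constructor
  · rintro ⟨z, ⟨j, hj, hz⟩, w, hzw⟩
    rw [hxy, Sym2.eq_iff] at hzw
    rcases hzw with ⟨h1, _⟩ | ⟨_, h2⟩
    · rw [← h1] at hz
      have hji : j = i := by
        by_contra hne
        exact hb.arm_disj j i hne x hz hx
      rw [← hji]; exact hj
    · rw [← h2] at hz
      have hij : i = j := hb.arm_eq_of_edge hxy hx hz
      rw [hij]; exact hj
  · intro hi
    exact ⟨x, ⟨i, hi, hx⟩, y, hxy⟩

/-- The value of the arm realisation on an edge with an end in `A i`. -/
lemma CoreBaseE.coreReal_apply_of_mem {ω : Config ι} {i : ι} {e : E} {x y : V}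
    (hxy : ends e = s(x, y)) (hx : x ∈ A i) :
    coreReal ends A ζ ω e = (if ω i = true then ζ e else !ζ e) := by
  unfold coreReal
  by_cases hi : ω i = true
  · rw [flip_apply_of_notMem, if_pos hi]
    rw [hb.touches_armsFalseC_iff hxy hx, hi]; decide
  · rw [flip_apply_of_mem, if_neg hi]
    rw [hb.touches_armsFalseC_iff hxy hx]
    simpa using hi

omit hb in
/-- The realisation on an h–u edge: the base colour iff `ω none = true`. -/
lemma CoreBaseE.coreRealE_apply_hu {ω : Config (Option ι)} {e : E} (he : ends e = s(h, u)) :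
    coreRealE ends A h u ζ ω e = (if ω none = true then ζ e else !ζ e) := by
  simp only [coreRealE, if_pos he]

/-- The realisation on an edge with an end in `A i`: the base colour iff `ω (some i) = true`. -/
lemma CoreBaseE.coreRealE_apply_of_mem {ω : Config (Option ι)} {i : ι} {e : E} {x y : V}
    (hxy : ends e = s(x, y)) (hx : x ∈ A i) :
    coreRealE ends A h u ζ ω e = (if ω (some i) = true then ζ e else !ζ e) := by
  simp only [coreRealE, if_neg (hb.not_hu_of_mem hxy hx)]
  exact hb.coreReal_apply_of_mem hxy hx

omit hb in
/-- The realisation on an edge with no end in an arm that is not an h–u edge: the base colour. -/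
lemma CoreBaseE.coreRealE_apply_of_notMem {ω : Config (Option ι)} {e : E}
    (he : e ∉ touches ends (allArms A)) (hhu : ends e ≠ s(h, u)) :
    coreRealE ends A h u ζ ω e = ζ e := by
  simp only [coreRealE, if_neg hhu]
  exact CoreBase.coreReal_apply_of_notMem he

/-- An edge inside `A i ∪ {h}` or `A i ∪ {u}` is untouched by the realisation of a cube point
with `A i` red: its colour is the base colour. -/
lemma CoreBaseE.coreRealE_apply_of_within {ω : Config (Option ι)} {i : ι}
    (hi : ω (some i) = true) {v : V} (hv : v = h ∨ v = u) {e : E}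
    (he : e ∈ within ends (A i ∪ {v})) : coreRealE ends A h u ζ ω e = ζ e := by
  obtain ⟨x, hx, y, hy, hxy⟩ := he
  rcases hx with hx | hx
  · rw [hb.coreRealE_apply_of_mem hxy hx, if_pos hi]
  · rcases hy with hy | hy
    · rw [hb.coreRealE_apply_of_mem (ends_swap hxy) hy, if_pos hi]
    · -- a loop at `h` or at `u`
      exfalso
      rw [Set.mem_singleton_iff] at hx hy
      subst hx; subst hy
      rcases hv with rfl | rfl
      · exact hb.loop_h e hxy
      · exact hb.loop_u e hxy

/-- The red edges inside `A i ∪ {v}` of the base are red in every realisation with `A i` red. -/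
lemma CoreBaseE.insideConfig_le_coreRealE {ω : Config (Option ι)} {i : ι}
    (hi : ω (some i) = true) {v : V} (hv : v = h ∨ v = u) :
    insideConfig ends (A i ∪ {v}) ζ ≤ coreRealE ends A h u ζ ω := by
  intro e
  by_cases he : insideConfig ends (A i ∪ {v}) ζ e = true
  · rw [he]
    obtain ⟨hζe, hw⟩ := insideConfig_eq_true_iff.1 he
    rw [hb.coreRealE_apply_of_within hi hv hw, hζe]
  · simp only [Bool.not_eq_true] at he
    rw [he]
    exact Bool.false_le _

/-- **The realisation is injective.** -/
theorem CoreBaseE.coreRealE_injective : Function.Injective (coreRealE ends A h u ζ) := by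
  intro ω ω' heq
  have key : ∀ (e : E) (b b' : Bool), b ≠ b' →
      (if b = true then ζ e else !ζ e) ≠ (if b' = true then ζ e else !ζ e) := by
    intro e b b' hbb'
    cases b <;> cases b' <;> simp at hbb' ⊢
  funext j
  cases j with
  | none =>
    obtain ⟨e, he⟩ := hb.hu_exists
    have h1 := CoreBaseE.coreRealE_apply_hu (A := A) (ζ := ζ) (ω := ω) he
    have h2 := CoreBaseE.coreRealE_apply_hu (A := A) (ζ := ζ) (ω := ω') he
    rw [heq] at h1
    rw [h1] at h2
    by_contra hne
    exact key e _ _ hne h2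
  | some i =>
    obtain ⟨x, hx⟩ := hb.arm_nonempty i
    -- `x` carries an edge
    have hxe : ∃ e, x ∈ ends e := by
      by_cases hp : pure i
      · have := hb.pure_conn i hp x hx
        exact exists_edge_of_mem_cluster (h := u) this (hb.arm_sub i x hx).2.2
      · have := hb.harm_conn i hp x hx
        exact exists_edge_of_mem_cluster (h := h) this (hb.arm_sub i x hx).2.1
    obtain ⟨e, hxe⟩ := hxe
    have hxy : ends e = s(x, Sym2.Mem.other hxe) := (Sym2.other_spec hxe).symm
    have h1 := hb.coreRealE_apply_of_mem (ω := ω) hxy hx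
    have h2 := hb.coreRealE_apply_of_mem (ω := ω') hxy hx
    rw [heq] at h1
    rw [h1] at h2
    by_contra hne
    exact key e _ _ hne h2

end Base

end LocRows

end Summit.Ventures.PercRepro2
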